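-- FILED by prover-pub-hodgecm2-tr-typer-6-0 (TRANSPOSITION typer item 6) 2026-08-21, VERBATIM from HOME/transposition/assembly/Assembly.lean md5 99e46643c796 (lead gen 6, HOME/INBOX l.3657); HC_CM is NOT proved.
/-
Copyright: COR-CM cell pub-hodgecm2.  AUTHORED by the stage-2 LEAD gen 6 (planner-pub-hodgecm2-lead-g6-0) as the DAY-1 TARGET of
the TRANSPOSITION surge (hodge-director/TRANSPOSITION-MAP.md §0/§4; COORDINATOR RE-POINT 2026-08-21T12:07:17Z (3) «INTERFACE-FIRST»).
To be FILED verbatim by the typer seat the lead names in HOME/INBOX (lead cannot file under CorCM/); target path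
`lean/Summits/HodgeConjecture/CorCM/B01/Transposition/Assembly.lean`.
-/
import Summits.HodgeConjecture.CorCM.B01.ThetaRealisationSocket
import Summits.HodgeConjecture.CorCM.FacePeriodWitnesses
import HarnessLib

/-!
# Transposition — the day-1 assembly: `RealisationExistsFace∃` in socket form, and HC_CM from it BY NAME

FRAMING (COORDINATOR RULING 2026-08-21T11:55:35Z): `HC_CM` is NOT proved.  This file proves NO instance of its hypothesis; it
only fixes the TYPE the six interface items (rfwf v3 §4.2 (i)–(vi), `Transposition/Item1…Item6*.lean`) must jointly inhabit, in
the ∃-quantifier form PerL actually delivers (RE-POINT (1)(2): ONE admissible `ι₁`, ONE hermitian 3-space `V` per field-and-face;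
no `LandherrExists`, no `AdmissibleExists`, no `∀ V`).

* `Universe.FaceThetaDataExists U` — for every Galois CM field `F` with `6 ≤ [F:ℚ]` and every rank-four face `f` of `F`:
  SOME admissible `ι₁`, SOME `V : HermSpace3 F ι₁`, and face-scoped theta-realisation data
  `U.FaceThetaDatum ι₁ V F f.psi ι₁` (`B01/ThetaRealisationSocket.lean:66`: fields `HG, emb` = item (iii); `Theta, Theta_sub` =
  items (ii)+(vi-supply); `lineField` = item (vi-wedge) (B01-H shape); `coupling` = item (v) (B01-O shape); `cover, emb_cover,
  inner_emb` = item (iii)/(i) bookkeeping).  Item (iv) (sign table / common plane `∃ W ⊂ V`) is UPSTREAM of the constructor of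
  `Theta` and is not a field of the socket.
* `Universe.exists_facePeriod_of_faceThetaDataExists` — the engine `periodNV_of_faceThetaDatum` (:106) run per face: the
  ∃-witness form of `PeriodThmF` consumed by `w_rk4_of_exists_periodNV` (`FacePeriodWitnesses.lean:74`).
* `Model.hc_cm_closed_of_faceThetaDataExists` — on the universe of record `U_rec` (the four tree theorems), face theta data for
  every field and face ⇒ `HC_CM`, by `hc_cm_closed_of_exists_facePeriod` (:189).  Binder count: ONE (`FaceThetaDataExists U_rec`).

No new axiom, no `sorry`, no named fact consumed beyond those already under `hc_cm_closed_of_exists_facePeriod`; `U.PerL` idle.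
-/

noncomputable section

namespace Summit.HodgeConjecture.CorCM

open Literature.AlgebraicGeometry.Motives (CMType)
open Literature.AlgebraicGeometry.HodgeTheory
open Literature.NumberTheory.Automorphic
open Literature.NumberTheory.Automorphic.PicardCM

namespace Universe

variable (U : Universe)

/-- **`RealisationExistsFace∃` (socket form).**  Every rank-four face of every Galois CM field of degree `≥ 6` carries, at SOME
admissible eigen-embedding `ι₁` and on the Picard modular surfaces of SOME hermitian 3-space `V`, face-scoped theta-realisation data
(`FaceThetaDatum`, `B01/ThetaRealisationSocket.lean:66`).  Displayed hypothesis — the conjunction the six interface items must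
build; asserted by no one. -/
@[conjecture]
def FaceThetaDataExists : Prop :=
  ∀ (F : CMField), IsGalois ℚ F → 6 ≤ Module.finrank ℚ F → ∀ f : Face F,
    ∃ ι₁ : F →+* ℂ, f.Admissible ι₁ ∧ ∃ V : HermSpace3 F ι₁, Nonempty (U.FaceThetaDatum ι₁ V F f.psi ι₁)

variable {U}

/-- The engine per face: face theta data at some `(ι₁, V)` give the ∃-witness form of `PeriodThmF` (with `σ = ι₁`). [folklore] -/
theorem exists_facePeriod_of_faceThetaDataExists (hc : U.Fact_pull_comp) (hH : U.Fact_pull_hodge)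
    (hcup2 : U.Fact_cup2_hodge) (hpc : U.Fact_pull_cup) (h : U.FaceThetaDataExists) :
    ∀ (F : CMField), IsGalois ℚ F → 6 ≤ Module.finrank ℚ F → ∀ f : Face F,
      ∃ ι₁ : F →+* ℂ, f.Admissible ι₁ ∧ ∃ (V : HermSpace3 F ι₁) (σ : F →+* ℂ), U.PeriodNV ι₁ V F f.psi σ := by
  intro F hG h6 f
  obtain ⟨ι₁, hι, V, ⟨R⟩⟩ := h F hG h6 f
  exact ⟨ι₁, hι, V, ι₁, periodNV_of_faceThetaDatum hc hH hcup2 hpc R⟩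

/-- The ∀-form is a special case: theta data at EVERY `(ι₁, V)` (the hypothesis of `periodThmF_of_faceThetaData`, :164) and the
existence of one admissible `ι₁` per face give `FaceThetaDataExists` (any `V`, e.g. the diagonal one, will do) — recorded only to
show the ∃-form is the weaker interface. [folklore] -/
theorem faceThetaDataExists_of_forall (hadm : AdmissibleExists) (hV : ∀ (F : CMField) (ι₁ : F →+* ℂ), Nonempty (HermSpace3 F ι₁))
    (hR : ∀ (F : CMField), IsGalois ℚ F → 6 ≤ Module.finrank ℚ F → ∀ (f : Face F) (ι₁ : F →+* ℂ), f.Admissible ι₁ →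
      ∀ V : HermSpace3 F ι₁, Nonempty (U.FaceThetaDatum ι₁ V F f.psi ι₁)) :
    U.FaceThetaDataExists := by
  intro F hG h6 f
  obtain ⟨ι₁, hι⟩ := hadm F h6 f
  obtain ⟨V⟩ := hV F ι₁
  exact ⟨ι₁, hι, V, hR F hG h6 f ι₁ hι V⟩

end Universe

namespace Model

/-- **HC_CM from face theta data on the universe of record, BY NAME** (day-1 target of the transposition surge; ONE binder).
`HC_CM` is NOT proved: nobody has inhabited `FaceThetaDataExists U_rec`. [folklore] -/
theorem hc_cm_closed_of_faceThetaDataExists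
    (h : (picardCMUniverse exists_isReal_hodgeModel_holds hodgePQ_independent_of_hodgeModel_holds
      BallQuotient.ballQuotientUniformised_holds cmAbelianVarietyRealised_holds).FaceThetaDataExists) : HC_CM :=
  hc_cm_closed_of_exists_facePeriod
    (Universe.exists_facePeriod_of_faceThetaDataExists
      (universeOf_fact_pull_comp _ _ (ballQuotientUniformisedDatum_of BallQuotient.ballQuotientUniformised_holds) _)
      (universeOf_fact_pull_hodge _ _ (ballQuotientUniformisedDatum_of BallQuotient.ballQuotientUniformised_holds) _)
      (universeOf_fact_cup2_hodge _ _ (ballQuotientUniformisedDatum_of BallQuotient.ballQuotientUniformised_holds) _)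
      (universeOf_fact_pull_cup _ _ (ballQuotientUniformisedDatum_of BallQuotient.ballQuotientUniformised_holds) _) h)

#print axioms hc_cm_closed_of_faceThetaDataExists

end Model

end Summit.HodgeConjecture.CorCM
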